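import Summits.CriticalPhenomena.Ising3DConformalLimit.Theorems.AnomalousForcesInteractionGaussianLimitIsFreeGermRigidity
import Summits.CriticalPhenomena.Ising3DConformalLimit.Theorems.AnomalousForcesInteractionGaussianLimitIsFreeSphereDecoupling
import HarnessLib

/-!
# Crux `GaussianLimitIsFree` (item stmt-CriticalPhenomena-2601), line `registered` (v10, lead c4):
# Gaussian rigidity from the `L²` decoupling inequality across the unit sphere

THEOREM-ONLY file (`--supports stmt-CriticalPhenomena-2601`), companion of
`…GaussianLimitIsFreeSphereDecoupling.lean`.

`delta_eq_half_of_sphereDecoupling`: for `A > 0`, `1/2 ≤ Δ ≤ 1` and a centred Gaussian probability law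
`μ` on `𝒮'(ℝ³)` with moment densities `(√A)ⁿ · W_Δ` (two-point function `A‖x−y‖^{-2Δ}`) which satisfies
the decoupling inequality (D_ε) across the unit sphere for all widths `ε ∈ (0, ε₀)` —
`|E[ω(w)ω(v)]| ≤ ‖E[ω(w) | 𝒜((∂B)^ε)]‖₂ ‖ω(v)‖₂` for `w` supported in the open unit ball and `v`
supported off `B̄(0, 1+ε)` — one has `Δ = 1/2`.  This is the landed `stub_gaussMarkovRigidity`
(…GermRigidity.lean, p161394: Pitt 1971 / Kotani 1973 Thm 2 / Rozanov 1982 Ch. 3 §2.3 for the Riesz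
covariances, proved directly) with its only use of the germ-Markov hypothesis (K) — the covariance bound
across the sphere — replaced by (D): the vanishing of the covariance across the sphere is
`twoPoint_eq_zero_of_sphereDecoupling`, and the rest of the assembly (radial shell pair
`stub_radialShellPair`, detectability, second-order far field `stub_farField_expansion`, whose coefficient
`Δ(2Δ−1)/3` vanishes exactly at `Δ = 1/2`) is repeated verbatim.  Translation invariance and reflection
positivity are not used.  (D) is implied by each Markov form at the unit ball — germ form (K), Rozanov's
collar form, the thick-shell form of the lattice theorem `Theorems.stub_thickShellMarkov` — see
`sphereDecoupling_of_germSplitting`, `sphereDecoupling_of_shellSplitting`.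

References: L. D. Pitt, ARMA 43 (1971) 367–391; S. Kotani, LNM 330 (1973) 239–250, Thm 2; Yu. A. Rozanov,
*Markov Random Fields* (1982), Ch. 3 §2.3 Theorem (p. 115).
-/

noncomputable section

namespace Summit.CriticalPhenomena.Ising3DConformalLimit.Cruxes.GaussianLimitIsFree.Birth

open MeasureTheory Filter Set
open scoped ProbabilityTheory Topology ENNReal
open Literature.MathematicalPhysics.QuantumLattice

section Assembly

open scoped SchwartzMap

/-- **Gaussian rigidity from the decoupling inequality (D) across the unit sphere.**  For `A > 0`,
`1/2 ≤ Δ ≤ 1` and a centred Gaussian probability law `μ` on `𝒮'(ℝ³)` with moment densities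
`(√A)ⁿ · W_Δ` such that, for some `ε₀ > 0` and all `ε ∈ (0, ε₀)`, all `w` supported in the open unit ball
and all `v` supported off `B̄(0, 1+ε)`,
`|∫ ω(w)ω(v) dμ| ≤ (∫ E[ω(w) | fieldSigma ((∂B)^ε)]² dμ)^{1/2} (∫ ω(v)² dμ)^{1/2}`, one has `Δ = 1/2`.
Proof: if `Δ > 1/2`, the radial shell pair `u₁, u₂` of `stub_radialShellPair`, `λ = U₁(e)/U₂(e)`,
`w = u₁ − λu₂` (Riesz potential vanishing on the unit sphere) has `E[ω(w)ω(v)] = 0` for all `v` outside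
the closed ball (`twoPoint_eq_zero_of_sphereDecoupling`), so the exterior potential of `w` vanishes
(detectability), `U₁(te) = λU₂(te)` for `t > 1`, and the far field `stub_farField_expansion` forces
`m(u₁) = λm(u₂)`, `M₂(u₁) = λM₂(u₂)`, contradicting the moment bounds of the two shells.
[cite: Rozanov1982, Ch. 3 §2.3 Theorem (p. 115)] -/
theorem delta_eq_half_of_sphereDecoupling :
    ∀ (Δ A : ℝ)
      (μ : MeasureTheory.Measure (Literature.MathematicalPhysics.QuantumLattice.FieldConfig (EuclideanSpace ℝ (Fin 3)))),
      0 < A → 1 / 2 ≤ Δ → Δ ≤ 1 →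
      MeasureTheory.IsProbabilityMeasure μ →
      Literature.MathematicalPhysics.QuantumLattice.IsGaussianField μ →
      (∀ (n : ℕ) (f : Fin n → SchwartzMap (EuclideanSpace ℝ (Fin 3)) ℝ), Literature.MathematicalPhysics.QuantumLattice.moment μ n f = ∫ x : Fin n → EuclideanSpace ℝ (Fin 3), (Real.sqrt A ^ n * Summit.CriticalPhenomena.Ising3DConformalLimit.MoebiusLimitExistsOnlyInteraction.wickPower Δ n x) * ∏ i, f i (x i)) →
      ∀ (ε₀ : ℝ), 0 < ε₀ →
      (∀ ε : ℝ, 0 < ε → ε < ε₀ → ∀ (w v : SchwartzMap (EuclideanSpace ℝ (Fin 3)) ℝ),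
        tsupport ⇑w ⊆ Metric.ball (0 : EuclideanSpace ℝ (Fin 3)) 1 →
        tsupport ⇑v ⊆ (Metric.closedBall (0 : EuclideanSpace ℝ (Fin 3)) (1 + ε))ᶜ →
        |∫ ω, ω w * ω v ∂μ| ≤
          Real.sqrt (∫ ω, (MeasureTheory.condExp
            (Literature.MathematicalPhysics.QuantumLattice.fieldSigma
              (Metric.thickening ε (Metric.sphere (0 : EuclideanSpace ℝ (Fin 3)) 1))) μ
            (fun ω : Literature.MathematicalPhysics.QuantumLattice.FieldConfig (EuclideanSpace ℝ (Fin 3)) => ω w)) ω ^ 2 ∂μ) *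
          Real.sqrt (∫ ω, (ω v) ^ 2 ∂μ)) →
      Δ = 1 / 2 := by
  intro Δ A μ hA h1 h2 hP hG hmom ε₀ hε₀ hD
  by_contra hne
  have hΔ : 1 / 2 < Δ := lt_of_le_of_ne h1 (fun h => hne h.symm)
  -- two-point function of the realised law
  have h2pt : ∀ u v : 𝓢((EuclideanSpace ℝ (Fin 3)), ℝ), twoPoint μ u v = A * ∫ x, ∫ y, u x * ‖x - y‖ ^ (-(2 * Δ)) * v y :=
    fun u v => twoPoint_eq_of_wickMoments hA.le (by linarith) (by linarith) hmom u v
  -- the radial shell pair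
  obtain ⟨u₁, u₂, hs1, hs2, hm1, hM1, hM2, hU1e, hU2e, hint, hsph, hodd1, hodd2, hsq1, hsq2, hdet⟩ :=
    stub_radialShellPair Δ hΔ h2
  set e : (EuclideanSpace ℝ (Fin 3)) := EuclideanSpace.single (0 : Fin 3) (1 : ℝ) with he_def
  have he : ‖e‖ = 1 := by
    rw [he_def]
    simp
  set U1e : ℝ := ∫ y, u₁ y * ‖y - e‖ ^ (-(2 * Δ)) with hU1e_def
  set U2e : ℝ := ∫ y, u₂ y * ‖y - e‖ ^ (-(2 * Δ)) with hU2e_def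
  set lam : ℝ := U1e / U2e with hlam
  have hlam_pos : 0 < lam := div_pos hU1e hU2e
  set w : 𝓢((EuclideanSpace ℝ (Fin 3)), ℝ) := u₁ - lam • u₂ with hw_def
  have hw_apply : ∀ y, w y = u₁ y - lam * u₂ y := fun y => by
    simp [hw_def, smul_eq_mul]
  have hw_supp : tsupport ⇑w ⊆ Metric.ball (0 : (EuclideanSpace ℝ (Fin 3))) 1 :=
    (tsupport_sub_smul_subset Metric.isClosed_closedBall hs1 hs2 lam).trans
      (Metric.closedBall_subset_ball (by norm_num))
  have hw_sphere : ∀ x : (EuclideanSpace ℝ (Fin 3)), ‖x‖ = 1 → ∫ y, w y * ‖y - x‖ ^ (-(2 * Δ)) = 0 := by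
    intro x hx
    have hsplit : ∫ y, w y * ‖y - x‖ ^ (-(2 * Δ)) =
        (∫ y, u₁ y * ‖y - x‖ ^ (-(2 * Δ))) - lam * ∫ y, u₂ y * ‖y - x‖ ^ (-(2 * Δ)) := by
      rw [← integral_const_mul, ← integral_sub (hint x).1 ((hint x).2.const_mul lam)]
      refine integral_congr_ae (Eventually.of_forall fun y => ?_)
      simp only [hw_apply]
      ring
    rw [hsplit, (hsph x hx).1, (hsph x hx).2]
    have hU2ne : U2e ≠ 0 := hU2e.ne'
    simp only [hlam]
    field_simp
    ring
  -- vanishing of the covariance across the sphere, hence of the exterior potential of `w`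
  haveI := hP
  have hzero : ∀ v : 𝓢((EuclideanSpace ℝ (Fin 3)), ℝ), tsupport ⇑v ⊆ (Metric.closedBall (0 : (EuclideanSpace ℝ (Fin 3))) 1)ᶜ →
      ∫ x, ∫ y, w x * ‖x - y‖ ^ (-(2 * Δ)) * v y = 0 := by
    intro v hv
    have h0 := twoPoint_eq_zero_of_sphereDecoupling hΔ h2 hA hG h2pt hw_supp hw_sphere hε₀
      (fun ε hε hεε₀ v' hv' => hD ε hε hεε₀ w v' hw_supp hv') hv
    rw [h2pt] at h0
    rcases mul_eq_zero.1 h0 with hA0 | hI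
    · exact absurd hA0 hA.ne'
    · exact hI
  have hext : ∀ t₀ : ℝ, 1 < t₀ →
      (∫ y, u₁ y * ‖y - t₀ • e‖ ^ (-(2 * Δ))) - lam * ∫ y, u₂ y * ‖y - t₀ • e‖ ^ (-(2 * Δ)) = 0 := by
    intro t₀ ht₀
    by_contra hne'
    obtain ⟨v, hv, hvK⟩ := hdet lam t₀ ht₀ hne'
    exact hvK (hzero v hv)
  -- far field of `u₁` and `u₂`
  set P1 : ℝ → ℝ := fun t => ∫ y, u₁ y * ‖y - t • e‖ ^ (-(2 * Δ)) with hP1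
  set P2 : ℝ → ℝ := fun t => ∫ y, u₂ y * ‖y - t • e‖ ^ (-(2 * Δ)) with hP2
  set m₁ : ℝ := ∫ y, u₁ y with hm₁
  set m₂ : ℝ := ∫ y, u₂ y with hm₂
  set M₁ : ℝ := ∫ y, u₁ y * ‖y‖ ^ 2 with hM₁
  set M₂ : ℝ := ∫ y, u₂ y * ‖y‖ ^ 2 with hM₂
  have hs1' : tsupport ⇑u₁ ⊆ Metric.closedBall (0 : (EuclideanSpace ℝ (Fin 3))) 1 :=
    hs1.trans (Metric.closedBall_subset_closedBall (by norm_num))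
  have hs2' : tsupport ⇑u₂ ⊆ Metric.closedBall (0 : (EuclideanSpace ℝ (Fin 3))) 1 :=
    hs2.trans (Metric.closedBall_subset_closedBall (by norm_num))
  have T1 : Tendsto (fun t : ℝ => t ^ 2 * (t ^ (2 * Δ) * P1 t - m₁)) atTop
      (𝓝 ((Δ * (2 * Δ - 1) / 3) * M₁)) := by
    have h := stub_farField_expansion Δ (by linarith) u₁ hs1' e he
    rw [hodd1, hsq1] at h
    have hlim : 2 * Δ * (Δ + 1) * ((1 / 3) * M₁) - Δ * M₁ = (Δ * (2 * Δ - 1) / 3) * M₁ := by ring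
    rw [hlim] at h
    refine h.congr' (Eventually.of_forall fun t => ?_)
    simp only [hP1, hm₁, mul_zero, sub_zero]
  have T2 : Tendsto (fun t : ℝ => t ^ 2 * (t ^ (2 * Δ) * P2 t - m₂)) atTop
      (𝓝 ((Δ * (2 * Δ - 1) / 3) * M₂)) := by
    have h := stub_farField_expansion Δ (by linarith) u₂ hs2' e he
    rw [hodd2, hsq2] at h
    have hlim : 2 * Δ * (Δ + 1) * ((1 / 3) * M₂) - Δ * M₂ = (Δ * (2 * Δ - 1) / 3) * M₂ := by ring
    rw [hlim] at h
    refine h.congr' (Eventually.of_forall fun t => ?_)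
    simp only [hP2, hm₂, mul_zero, sub_zero]
  -- first order: `m₁ = lam m₂`
  have F1 : Tendsto (fun t : ℝ => t ^ (2 * Δ) * P1 t - m₁) atTop (𝓝 0) := tendsto_zero_of_tendsto_sq_mul T1
  have F2 : Tendsto (fun t : ℝ => t ^ (2 * Δ) * P2 t - m₂) atTop (𝓝 0) := tendsto_zero_of_tendsto_sq_mul T2
  have hPrel : ∀ᶠ t : ℝ in atTop, P1 t = lam * P2 t := by
    filter_upwards [eventually_gt_atTop (1 : ℝ)] with t ht
    have := hext t ht
    simp only [hP1, hP2]
    linarith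
  have hm_rel : m₁ - lam * m₂ = 0 := by
    -- the function `(t^{2Δ} P1 t - m₁) - lam (t^{2Δ} P2 t - m₂)` is eventually the constant `-(m₁ - lam m₂)`
    have hc : Tendsto (fun t : ℝ => (t ^ (2 * Δ) * P1 t - m₁) - lam * (t ^ (2 * Δ) * P2 t - m₂)) atTop
        (𝓝 (0 - lam * 0)) := F1.sub (F2.const_mul lam)
    rw [mul_zero, sub_zero] at hc
    have hc' : Tendsto (fun _ : ℝ => -(m₁ - lam * m₂)) atTop (𝓝 0) := by
      refine hc.congr' ?_
      filter_upwards [hPrel] with t ht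
      rw [ht]
      ring
    have := tendsto_nhds_unique hc' tendsto_const_nhds
    linarith
  -- second order: `M₁ = lam M₂`
  have hM_rel : (Δ * (2 * Δ - 1) / 3) * (M₁ - lam * M₂) = 0 := by
    have hc : Tendsto (fun t : ℝ => t ^ 2 * (t ^ (2 * Δ) * P1 t - m₁) - lam * (t ^ 2 * (t ^ (2 * Δ) * P2 t - m₂)))
        atTop (𝓝 ((Δ * (2 * Δ - 1) / 3) * M₁ - lam * ((Δ * (2 * Δ - 1) / 3) * M₂))) :=
      T1.sub (T2.const_mul lam)
    have hc' : Tendsto (fun _ : ℝ => (0 : ℝ)) atTop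
        (𝓝 ((Δ * (2 * Δ - 1) / 3) * M₁ - lam * ((Δ * (2 * Δ - 1) / 3) * M₂))) := by
      refine hc.congr' ?_
      filter_upwards [hPrel] with t ht
      rw [ht]
      have : m₁ = lam * m₂ := by linarith
      rw [this]
      ring
    have := tendsto_nhds_unique hc' tendsto_const_nhds
    linarith
  have hcoef : (Δ * (2 * Δ - 1) / 3) ≠ 0 := by
    have : 0 < Δ * (2 * Δ - 1) / 3 := by
      have h2Δ : 0 < 2 * Δ - 1 := by linarith
      positivity
    exact this.ne'
  have hM_rel' : M₁ = lam * M₂ := by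
    have := (mul_eq_zero.1 hM_rel).resolve_left hcoef
    linarith
  -- arithmetic contradiction with the moment bounds of the two shells
  have hm₂pos : 0 < m₂ := by
    have : m₁ = lam * m₂ := by linarith
    by_contra hle
    push Not at hle
    have : m₁ ≤ 0 := by
      rw [this]
      exact mul_nonpos_of_nonneg_of_nonpos hlam_pos.le hle
    linarith
  have hlow : lam * ((1 / 4) * m₂) ≤ lam * M₂ := mul_le_mul_of_nonneg_left hM2 hlam_pos.le
  have hm1eq : m₁ = lam * m₂ := by linarith
  nlinarith [hM1, hlow, hM_rel', hm1eq, hm1, hlam_pos]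

/-- **Registered form (crux stmt-CriticalPhenomena-2601, line `registered`, skeleton v10; sub-goal of the
glue): Gaussian rigidity from the decoupling inequality (D)** — `delta_eq_half_of_sphereDecoupling`
verbatim. [cite: Rozanov1982, Ch. 3 §2.3 Theorem (p. 115)] -/
theorem stub_gaussRigidity_of_sphereDecoupling :
    ∀ (Δ A : ℝ) (μ : MeasureTheory.Measure (Literature.MathematicalPhysics.QuantumLattice.FieldConfig (EuclideanSpace ℝ (Fin 3)))), 0 < A → 1 / 2 ≤ Δ → Δ ≤ 1 → MeasureTheory.IsProbabilityMeasure μ → Literature.MathematicalPhysics.QuantumLattice.IsGaussianField μ → (∀ (n : ℕ) (f : Fin n → SchwartzMap (EuclideanSpace ℝ (Fin 3)) ℝ), Literature.MathematicalPhysics.QuantumLattice.moment μ n f = ∫ x : Fin n → EuclideanSpace ℝ (Fin 3), (Real.sqrt A ^ n * Summit.CriticalPhenomena.Ising3DConformalLimit.MoebiusLimitExistsOnlyInteraction.wickPower Δ n x) * ∏ i, f i (x i)) → ∀ (ε₀ : ℝ), 0 < ε₀ → (∀ ε : ℝ, 0 < ε → ε < ε₀ → ∀ (w v : SchwartzMap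 (EuclideanSpace ℝ (Fin 3)) ℝ), tsupport ⇑w ⊆ Metric.ball (0 : EuclideanSpace ℝ (Fin 3)) 1 → tsupport ⇑v ⊆ (Metric.closedBall (0 : EuclideanSpace ℝ (Fin 3)) (1 + ε))ᶜ → |∫ ω, ω w * ω v ∂μ| ≤ Real.sqrt (∫ ω, (MeasureTheory.condExp (Literature.MathematicalPhysics.QuantumLattice.fieldSigma (Metric.thickening ε (Metric.sphere (0 : EuclideanSpace ℝ (Fin 3)) 1))) μ (fun ω : Literature.MathematicalPhysics.QuantumLattice.FieldConfig (EuclideanSpace ℝ (Fin 3)) => ω w)) ω ^ 2 ∂μ) * Real.sqrt (∫ ω, (ω v) ^ 2 ∂μ)) → Δ = 1 / 2 :=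
  delta_eq_half_of_sphereDecoupling

end Assembly

end Summit.CriticalPhenomena.Ising3DConformalLimit.Cruxes.GaussianLimitIsFree.Birth

end
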